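import Literature.Combinatorics.SimpleGraph.ListTreeDecompositionSeparators
import HarnessLib

/-!
# Robertson–Seymour approximation of treewidth, list form, over a separator oracle

Topic `Literature/Combinatorics/SimpleGraph`, sequel of `ListTreeDecompositionSeparators.lean`.
The recursive procedure of Robertson–Seymour / Reed (Cygan et al., *Parameterized Algorithms*,
Thm. 7.18 and its proof: `decompose(S, W)` with `|W| ≤ 3k + 4`; pad `W` to `3k + 4` vertices,
split it by a separator `X` of size `≤ k + 1` with at most `2k + 2` vertices of `W` on either side,
output the bag `W ∪ X` and recurse; either `tw > k` is detected or a tree decomposition of width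
`≤ 4k + 4` is produced) as an iteration on lists, with the search for the separator delegated to an
ORACLE `oracle S forced : Option (labels of S)` — in the Markov–Shi machine this oracle is a
dynamic programme over an auxiliary decomposition, `MinCostLabeling.lean`; classically it is a
max-flow computation. Two deviations from the printed procedure, both simplifications: the
recursion is on the two SIDES of the separation rather than on the connected components of
`S ∖ (W ∪ X)` (no connectivity computation is needed; the sides are read off the labels), and it
is run as a worklist loop with fuel (a machine has no recursion).

* `pad`, `candidates` (the `3^{|W|}` labelings of `W` into side `0` / separator `1` / side `2` with
  at most `2k + 2` vertices on either side), `findSep` (the first candidate the oracle extends),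
  `side`, `labelOf`, `RSState`, `rsStep`, `rsRun`, `rsResult`;
* `OracleSound` (what a returned labeling guarantees: it extends the forced labels, uses labels
  `≤ 2`, has at most `k + 1` separator vertices and no edge from side `0` to side `2`) and
  `OracleComplete` (a labeling is returned whenever one with these properties exists);
* **`isRootedTDOn_rsResult`** (validity): over a sound oracle, a successful run outputs a rooted
  tree decomposition of `S₀` (list form, `IsRootedTDOn`) covering the edges inside `S₀`, all bags
  of size `≤ 4k + 5`;
* **`rsResult_isSome`** (completeness): over a sound and complete oracle, if `S₀` has SOME rooted
  decomposition covering its edges with bags of size `≤ k + 1` (i.e. treewidth `≤ k`), the run with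
  fuel `2|S₀| + 1` succeeds — by `exists_balanced_labeling` a good candidate exists at every split.

## References

* M. Cygan, F. V. Fomin, Ł. Kowalik, D. Lokshtanov, D. Marx, M. Pilipczuk, M. Pilipczuk,
  S. Saurabh, *Parameterized Algorithms*, Springer 2015, §7.6.2, Thm. 7.18 and its proof
  (procedure `decompose(W, S)`), Lemma 7.20, Cor. 7.21.
* N. Robertson, P. D. Seymour, *Graph minors. XIII*, J. Combin. Theory Ser. B 63 (1995) 65–110;
  B. A. Reed, *Finding approximate separators and computing tree width quickly*, STOC 1992
  (the original procedures; cited by Markov–Shi, Thm. 4.3).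
-/

namespace Literature.Combinatorics.SimpleGraph

namespace ListTD

open Finset

/-! ### Accessors on extended lists -/

/-- Appending a bag does not change the earlier bags. [folklore] -/
theorem bagOf_append_of_lt {bags : List (List ℕ)} {B : List ℕ} {t : ℕ} (h : t < bags.length) :
    bagOf (bags ++ [B]) t = bagOf bags t := by
  rw [bagOf_eq_getElem (by simp; omega), bagOf_eq_getElem h, List.getElem_append_left h]

/-- The appended bag. [folklore] -/
theorem bagOf_append_length {bags : List (List ℕ)} {B : List ℕ} : bagOf (bags ++ [B]) bags.length = B := by
  rw [bagOf_eq_getElem (by simp)]; simp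

/-- Bags of an extended list: old, new, or empty. [folklore] -/
theorem mem_bagOf_append {bags : List (List ℕ)} {B : List ℕ} {t v : ℕ} (h : v ∈ bagOf (bags ++ [B]) t) :
    (t < bags.length ∧ v ∈ bagOf bags t) ∨ (t = bags.length ∧ v ∈ B) := by
  rcases Nat.lt_trichotomy t bags.length with ht | rfl | ht
  · exact Or.inl ⟨ht, by rwa [bagOf_append_of_lt ht] at h⟩
  · exact Or.inr ⟨rfl, by rwa [bagOf_append_length] at h⟩
  · rw [bagOf_eq_nil (by simp; omega)] at h; simp at h

/-- Appending a parent does not change the earlier parents. [folklore] -/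
theorem parOf_append_of_lt {par : List ℕ} {p t : ℕ} (h : t < par.length) : parOf (par ++ [p]) t = parOf par t := by
  simp [parOf, List.getD_eq_getElem?_getD, List.getElem?_append_left h, List.getElem?_eq_getElem h]

/-- The appended parent. [folklore] -/
theorem parOf_append_length {par : List ℕ} {p : ℕ} : parOf (par ++ [p]) par.length = p := by
  simp [parOf, List.getD_eq_getElem?_getD]

/-! ### The procedure -/

/-- **Padding**: extend `W ⊆ S` by fresh vertices of `S` to `3k + 4` vertices (or to all of `S`).
[cite: CyganEtAl2015, Thm 7.18 (proof: "add arbitrary vertices of S ∖ W to W")] -/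
def pad (k : ℕ) (S W : List ℕ) : List ℕ :=
  W ++ ((S.filter fun v => decide (v ∉ W)).take (3 * k + 4 - W.length))

/-- **The candidate labelings of `W`**: all maps `W → {0, 1, 2}` (as value lists aligned with
`W`) with at most `2k + 2` vertices labeled `0` and at most `2k + 2` labeled `2`.
[cite: CyganEtAl2015, Thm 7.18 (proof: guessing the partition of W) and Cor 7.21] -/
def candidates (k : ℕ) (W : List ℕ) : List (List ℕ) :=
  (allAssign 3 W).filter fun c => decide (c.count 0 ≤ 2 * k + 2 ∧ c.count 2 ≤ 2 * k + 2)

/-- **The label of a vertex** under a labeling of `S` (value lists aligned with `S`; `0` off `S`).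
[folklore] -/
def labelOf (S lab : List ℕ) (v : ℕ) : ℕ := assignOf (S.zip lab) v

/-- **The vertices of `S` with a given label.** [folklore] -/
def side (S lab : List ℕ) (a : ℕ) : List ℕ := S.filter fun v => decide (labelOf S lab v = a)

/-- **Searching a separator**: the first candidate labeling of `W` that the oracle extends to `S`.
[cite: CyganEtAl2015, Thm 7.18 (proof)] -/
def findSep (oracle : List ℕ → List (ℕ × ℕ) → Option (List ℕ)) (k : ℕ) (S W : List ℕ) : Option (List ℕ) :=
  (candidates k W).findSome? fun c => oracle S (W.zip c)

/-- **The state of the worklist run**: pending tasks `(S, W, parent bag index)`, the parents and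
bags produced so far, and a success flag. [folklore] -/
structure RSState where
  /-- Pending tasks `(S, W, p)`: decompose `S` with interface `W ⊆ S` below the bag `p`. -/
  work : List (List ℕ × List ℕ × ℕ)
  /-- Parents of the bags produced so far. -/
  par : List ℕ
  /-- Bags produced so far. -/
  bags : List (List ℕ)
  /-- No separator search has failed. -/
  ok : Bool

/-- **One step of the procedure** on the first pending task `(S, W, p)`: pad `W` to `W'`; if
`S ⊆ W'`, emit the leaf bag `W'`; otherwise search a separator labeling of `S` extending a balanced
labeling of `W'`: on failure lower the flag, on success emit the bag `W' ∪ X` (`X` the separator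
vertices, capped at `k + 1`) and push the two sides, each with interface (its part of `W'`, capped
at `2k + 2`) `∪ X`. The caps are no-ops over a sound oracle; they make all sizes bounded outright.
[cite: CyganEtAl2015, Thm 7.18 (proof: procedure decompose)] -/
def rsStep (oracle : List ℕ → List (ℕ × ℕ) → Option (List ℕ)) (k : ℕ) (st : RSState) : RSState :=
  match st.work with
  | [] => st
  | (S, W, p) :: rest =>
    if S.all fun v => decide (v ∈ pad k S W) then
      ⟨rest, st.par ++ [p], st.bags ++ [pad k S W], st.ok⟩
    else
      match findSep oracle k S (pad k S W) with
      | none => ⟨rest, st.par, st.bags, false⟩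
      | some lab =>
        ⟨(side S lab 0 ++ (side S lab 1).take (k + 1),
            ((pad k S W).filter fun v => decide (labelOf S lab v = 0)).take (2 * k + 2) ++
              (side S lab 1).take (k + 1), st.bags.length) ::
          (side S lab 2 ++ (side S lab 1).take (k + 1),
            ((pad k S W).filter fun v => decide (labelOf S lab v = 2)).take (2 * k + 2) ++
              (side S lab 1).take (k + 1), st.bags.length) :: rest,
         st.par ++ [p],
         st.bags ++ [pad k S W ++ ((side S lab 1).take (k + 1)).filter fun v => decide (v ∉ pad k S W)],
         st.ok⟩

/-- The initial state: one task, all of `S₀` below a virtual root. [folklore] -/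
def rsInit (S₀ : List ℕ) : RSState := ⟨[(S₀, [], 0)], [], [], true⟩

/-- **The run** with fuel. [cite: CyganEtAl2015, Thm 7.18] -/
def rsRun (oracle : List ℕ → List (ℕ × ℕ) → Option (List ℕ)) (k : ℕ) (S₀ : List ℕ) (fuel : ℕ) : RSState :=
  (rsStep oracle k)^[fuel] (rsInit S₀)

/-- **The result**: the decomposition if the run finished all tasks without failure.
[cite: CyganEtAl2015, Thm 7.18] -/
def rsResult (oracle : List ℕ → List (ℕ × ℕ) → Option (List ℕ)) (k : ℕ) (S₀ : List ℕ) (fuel : ℕ) :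
    Option (List ℕ × List (List ℕ)) :=
  if (rsRun oracle k S₀ fuel).work.isEmpty ∧ (rsRun oracle k S₀ fuel).ok = true then
    some ((rsRun oracle k S₀ fuel).par, (rsRun oracle k S₀ fuel).bags) else none

/-! ### Oracle specifications -/

/-- **Soundness of the oracle** w.r.t. the edge relation `E` and the parameter `k`: a returned
labeling of `S` has one label `≤ 2` per vertex, extends the forced labels, has at most `k + 1`
separator vertices and no edge from side `0` to side `2`. [cite: CyganEtAl2015, Thm 7.18 (proof: the separation found)] -/
def OracleSound (E : ℕ → ℕ → Prop) (k : ℕ) (S₀ : List ℕ) (oracle : List ℕ → List (ℕ × ℕ) → Option (List ℕ)) : Prop :=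
  ∀ S forced lab, S.Nodup → (∀ v ∈ S, v ∈ S₀) → oracle S forced = some lab →
    lab.length = S.length ∧ (∀ x ∈ lab, x ≤ 2) ∧
    (∀ q ∈ forced, q.1 ∈ S → labelOf S lab q.1 = q.2) ∧
    (side S lab 1).length ≤ k + 1 ∧
    (∀ u ∈ S, ∀ v ∈ S, E u v → labelOf S lab u = 0 → labelOf S lab v ≠ 2)

/-- **Completeness of the oracle**: if some labeling `ℓ` of the vertices with labels `≤ 2` extends
the forced labels, has at most `k + 1` separator vertices in `S` and no edge of `S` from side `0`
to side `2`, then the oracle answers. [cite: CyganEtAl2015, Thm 7.18 (proof: if tw ≤ k a separation exists and is found)] -/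
def OracleComplete (E : ℕ → ℕ → Prop) (k : ℕ) (S₀ : List ℕ) (oracle : List ℕ → List (ℕ × ℕ) → Option (List ℕ)) : Prop :=
  ∀ S forced, S.Nodup → (∀ v ∈ S, v ∈ S₀) → (∀ q ∈ forced, q.1 ∈ S) →
    (∃ ℓ : ℕ → ℕ, (∀ q ∈ forced, ℓ q.1 = q.2) ∧ (∀ v, ℓ v ≤ 2) ∧
      (S.filter fun v => decide (ℓ v = 1)).length ≤ k + 1 ∧
      (∀ u ∈ S, ∀ v ∈ S, E u v → ℓ u = 0 → ℓ v ≠ 2)) →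
    (oracle S forced).isSome = true

/-! ### Elementary facts on labels, sides, padding, candidates -/

section Basic

/-- A vertex of `S` has a label among the label list (aligned lists). [folklore] -/
theorem exists_labelOf_mem : ∀ (S lab : List ℕ) {v : ℕ}, v ∈ S → S.length ≤ lab.length →
    labelOf S lab v ∈ lab
  | [], _, _, hv, _ => by simp at hv
  | w :: S, [], _, _, hlen => by simp at hlen
  | w :: S, x :: lab, v, hv, hlen => by
    unfold labelOf
    rw [List.zip_cons_cons, assignOf_cons]
    by_cases h : v = w
    · subst h; simp
    · rw [if_neg h]
      exact List.mem_cons_of_mem _ (exists_labelOf_mem S lab ((List.mem_cons.1 hv).resolve_left h)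
        (by simpa using hlen))

/-- Labels of a sound labeling are `≤ 2`. [folklore] -/
theorem labelOf_le_two {S lab : List ℕ} (hlen : lab.length = S.length) (hlab : ∀ x ∈ lab, x ≤ 2) {v : ℕ}
    (hv : v ∈ S) : labelOf S lab v ≤ 2 :=
  hlab _ (exists_labelOf_mem S lab hv hlen.ge)

/-- The label of the `i`-th vertex is the `i`-th label (no repeated vertices). [folklore] -/
theorem labelOf_getElem : ∀ (S lab : List ℕ), S.Nodup → ∀ {i : ℕ} (hi : i < S.length) (hi' : i < lab.length),
    labelOf S lab S[i] = lab[i]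
  | [], _, _, i, hi, _ => by simp at hi
  | w :: S, [], _, i, _, hi' => by simp at hi'
  | w :: S, x :: lab, hnd, i, hi, hi' => by
    unfold labelOf
    rw [List.zip_cons_cons, assignOf_cons]
    cases i with
    | zero => simp
    | succ i =>
      have hi0 : i < S.length := by simpa using hi
      have hw : S[i] ≠ w := fun h => (List.nodup_cons.1 hnd).1 (h ▸ List.getElem_mem hi0)
      simp only [List.getElem_cons_succ, hw, if_false]
      exact labelOf_getElem S lab (List.nodup_cons.1 hnd).2 hi0 (by simpa using hi')

/-- Membership in a side. [folklore] -/
theorem mem_side {S lab : List ℕ} {a v : ℕ} : v ∈ side S lab a ↔ v ∈ S ∧ labelOf S lab v = a := by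
  simp [side]

/-- Sides of a list without repetition have none. [folklore] -/
theorem nodup_side {S lab : List ℕ} (h : S.Nodup) (a : ℕ) : (side S lab a).Nodup := h.filter _

/-- Membership in the padding. [folklore] -/
theorem mem_pad {k : ℕ} {S W : List ℕ} {v : ℕ} (h : v ∈ pad k S W) : v ∈ W ∨ (v ∈ S ∧ v ∉ W) := by
  rcases List.mem_append.1 h with h | h
  · exact Or.inl h
  · have := List.mem_of_mem_take h
    simp only [List.mem_filter, decide_eq_true_eq] at this
    exact Or.inr this

/-- The padding extends `W`. [folklore] -/
theorem subset_pad (k : ℕ) (S W : List ℕ) : ∀ v ∈ W, v ∈ pad k S W := fun _ hv => List.mem_append_left _ hv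

/-- The padding stays inside `S` (if `W ⊆ S`). [folklore] -/
theorem pad_subset {k : ℕ} {S W : List ℕ} (hWS : ∀ v ∈ W, v ∈ S) : ∀ v ∈ pad k S W, v ∈ S := fun v hv => by
  rcases mem_pad hv with h | h
  · exact hWS v h
  · exact h.1

/-- The padding has no repetition. [folklore] -/
theorem nodup_pad {k : ℕ} {S W : List ℕ} (hS : S.Nodup) (hW : W.Nodup) : (pad k S W).Nodup := by
  refine List.Nodup.append hW ((hS.filter _).sublist (List.take_sublist _ _)) fun v hvW hv => ?_
  have := List.mem_of_mem_take hv
  simp only [List.mem_filter, decide_eq_true_eq] at this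
  exact this.2 hvW

/-- The padding has at most `max |W| (3k+4)` vertices; with `|W| ≤ 3k + 4`, at most `3k + 4`. [folklore] -/
theorem length_pad_le {k : ℕ} {S W : List ℕ} (hW : W.length ≤ 3 * k + 4) : (pad k S W).length ≤ 3 * k + 4 := by
  simp only [pad, List.length_append, List.length_take]
  omega

/-- **If the padding does not exhaust `S`, it has exactly `3k + 4` vertices.** [folklore] -/
theorem length_pad_eq {k : ℕ} {S W : List ℕ} (hW : W.length ≤ 3 * k + 4)
    (h : ¬ ∀ v ∈ S, v ∈ pad k S W) : (pad k S W).length = 3 * k + 4 := by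
  simp only [pad, List.length_append, List.length_take]
  -- if fewer than `3k+4-|W|` fresh vertices were available, all of `S` would be covered
  by_contra hne
  have hlt : (S.filter fun v => decide (v ∉ W)).length < 3 * k + 4 - W.length := by
    rcases lt_or_ge (S.filter fun v => decide (v ∉ W)).length (3 * k + 4 - W.length) with h' | h'
    · exact h'
    · exfalso; apply hne; rw [min_eq_left h']; omega
  apply h
  intro v hv
  by_cases hvW : v ∈ W
  · exact List.mem_append_left _ hvW
  · refine List.mem_append_right _ ?_
    rw [List.take_of_length_le hlt.le]
    simpa using And.intro hv hvW

/-- Membership in the candidate list. [folklore] -/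
theorem mem_candidates {k : ℕ} {W c : List ℕ} :
    c ∈ candidates k W ↔ c ∈ allAssign 3 W ∧ c.count 0 ≤ 2 * k + 2 ∧ c.count 2 ≤ 2 * k + 2 := by
  simp [candidates]

/-- Counting a label along forced positions: if the `i`-th vertex of `W` carries the `i`-th
entry of `c`, the vertices of `W` with label `a` are as many as the entries `a` of `c`. [folklore] -/
theorem length_filter_label_eq_count (f : ℕ → ℕ) (a : ℕ) : ∀ (W c : List ℕ), c.length = W.length →
    (∀ (i : ℕ) (hi : i < W.length) (hi' : i < c.length), f W[i] = c[i]) →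
    (W.filter fun v => decide (f v = a)).length = c.count a
  | [], [], _, _ => by simp
  | [], _ :: _, h, _ => by simp at h
  | _ :: _, [], h, _ => by simp at h
  | w :: W, x :: c, hlen, hf => by
    have h0 : f w = x := hf 0 (by simp) (by simp)
    have ih := length_filter_label_eq_count f a W c (by simpa using hlen)
      fun i hi hi' => hf (i + 1) (by simpa using hi) (by simpa using hi')
    rw [List.filter_cons, List.count_cons]
    by_cases hx : x = a
    · subst hx; simp [h0, ih]
    · have : ¬ (f w = a) := by rw [h0]; exact hx
      simp [this, ih, beq_false_of_ne hx]

end Basic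

/-! ### The invariant of the run -/

section Invariant

variable (E : ℕ → ℕ → Prop) (k : ℕ) (S₀ : List ℕ)

/-- The **free vertices** of a task `(S, W, p)`: those of `S ∖ W`. [folklore] -/
def Free (τ : List ℕ × List ℕ × ℕ) (v : ℕ) : Prop := v ∈ τ.1 ∧ v ∉ τ.2.1

/-- **The invariant of the worklist run** (what the recursion of Robertson–Seymour maintains):
the bags produced so far form a rooted forest-in-progress with (T3) and bounded bag sizes; every
task `(S, W, p)` has `W ⊆ S ⊆ S₀` without repetitions, `|W| ≤ 3k + 3`, its interface `W` inside
the bag `p` already produced; its free vertices `S ∖ W` occur in no bag and in no other task; every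
vertex and every edge of `S₀` is in a bag or inside a pending task. [cite: CyganEtAl2015, Thm 7.18 (proof)] -/
structure RSInv (st : RSState) : Prop where
  /-- One parent entry per bag. -/
  length_par : st.par.length = st.bags.length
  /-- Parents carry smaller indices. -/
  par_lt : ∀ t, 0 < t → t < st.bags.length → parOf st.par t < t
  /-- Bags consist of vertices of `S₀`. -/
  bag_sub : ∀ t, ∀ v ∈ bagOf st.bags t, v ∈ S₀
  /-- Bags have no repetition. -/
  bag_nodup : ∀ t, (bagOf st.bags t).Nodup
  /-- Bags have at most `4k + 5` vertices. -/
  bag_len : ∀ t, (bagOf st.bags t).length ≤ 4 * k + 5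
  /-- (T3), rooted, for the bags so far. -/
  rooted : ∀ v s t, s < t → t < st.bags.length → v ∈ bagOf st.bags t → v ∈ bagOf st.bags s →
    v ∈ bagOf st.bags (parOf st.par t)
  /-- Every vertex is in a bag or in a pending task. -/
  cover : ∀ v ∈ S₀, (∃ t, t < st.bags.length ∧ v ∈ bagOf st.bags t) ∨ ∃ τ ∈ st.work, v ∈ τ.1
  /-- Every edge is in a bag or inside a pending task. -/
  coverE : ∀ u ∈ S₀, ∀ v ∈ S₀, E u v →
    (∃ t, t < st.bags.length ∧ u ∈ bagOf st.bags t ∧ v ∈ bagOf st.bags t) ∨ ∃ τ ∈ st.work, u ∈ τ.1 ∧ v ∈ τ.1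
  /-- Task vertex lists have no repetition. -/
  task_nodup : ∀ τ ∈ st.work, τ.1.Nodup
  /-- Task interfaces have no repetition. -/
  taskW_nodup : ∀ τ ∈ st.work, τ.2.1.Nodup
  /-- `W ⊆ S`. -/
  taskW_sub : ∀ τ ∈ st.work, ∀ v ∈ τ.2.1, v ∈ τ.1
  /-- `|W| ≤ 3k + 3`. -/
  taskW_len : ∀ τ ∈ st.work, τ.2.1.length ≤ 3 * k + 3
  /-- `S ⊆ S₀`. -/
  task_sub : ∀ τ ∈ st.work, ∀ v ∈ τ.1, v ∈ S₀
  /-- The parent bag of a task exists (once there are bags). -/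
  task_par : ∀ τ ∈ st.work, st.bags ≠ [] → τ.2.2 < st.bags.length
  /-- Before the first bag there is at most the initial task. -/
  init_shape : st.bags = [] → st.work.length ≤ 1
  /-- The interface lies in the parent bag. -/
  taskW_bag : ∀ τ ∈ st.work, ∀ v ∈ τ.2.1, v ∈ bagOf st.bags τ.2.2
  /-- Free vertices occur in no bag. -/
  fresh : ∀ τ ∈ st.work, ∀ v, Free τ v → ∀ t, t < st.bags.length → v ∉ bagOf st.bags t
  /-- Free vertices of different tasks are different. -/
  disj : st.work.Pairwise fun τ τ' => ∀ v, Free τ v → Free τ' v → False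
  /-- There is always a task or a bag. -/
  work_or_bags : st.work ≠ [] ∨ st.bags ≠ []

variable {E k S₀}

/-- The invariant holds initially. [folklore] -/
theorem rsInv_init (hS₀ : S₀.Nodup) : RSInv E k S₀ (rsInit S₀) := by
  refine ⟨rfl, fun t _ ht => by simp [rsInit] at ht, fun t v hv => ?_, fun t => ?_, fun t => ?_,
    fun v s t _ ht => by simp [rsInit] at ht, fun v hv => Or.inr ⟨_, List.mem_cons_self, hv⟩,
    fun u hu v hv _ => Or.inr ⟨_, List.mem_cons_self, hu, hv⟩, ?_, ?_, ?_, ?_, ?_, ?_, ?_, ?_, ?_, ?_, ?_⟩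
  all_goals simp_all [rsInit, bagOf, Free]

/-- **Emitting a bag and new tasks preserves the invariant**, given the local conditions that the
leaf step and the split step both establish. [cite: CyganEtAl2015, Thm 7.18 (proof)] -/
theorem rsInv_emit {st : RSState} (h : RSInv E k S₀ st) {S W : List ℕ} {p : ℕ}
    {rest : List (List ℕ × List ℕ × ℕ)} (hw : st.work = (S, W, p) :: rest)
    (B : List ℕ) (new : List (List ℕ × List ℕ × ℕ)) (ok : Bool)
    (hBS : ∀ v ∈ B, v ∈ S) (hBnd : B.Nodup) (hBlen : B.length ≤ 4 * k + 5)
    (hnewS : ∀ τ ∈ new, ∀ v ∈ τ.1, v ∈ S) (hnew_nd : ∀ τ ∈ new, τ.1.Nodup)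
    (hnewW_nd : ∀ τ ∈ new, τ.2.1.Nodup) (hnewW_sub : ∀ τ ∈ new, ∀ v ∈ τ.2.1, v ∈ τ.1)
    (hnewW_len : ∀ τ ∈ new, τ.2.1.length ≤ 3 * k + 3) (hnew_par : ∀ τ ∈ new, τ.2.2 = st.bags.length)
    (hnewW_B : ∀ τ ∈ new, ∀ v ∈ τ.2.1, v ∈ B)
    (hnew_free : ∀ τ ∈ new, ∀ v, Free τ v → Free (S, W, p) v ∧ v ∉ B)
    (hnew_disj : new.Pairwise fun τ τ' => ∀ v, Free τ v → Free τ' v → False)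
    (hcov : ∀ v ∈ S, v ∈ B ∨ ∃ τ ∈ new, v ∈ τ.1)
    (hcovE : ∀ u ∈ S, ∀ v ∈ S, E u v → (u ∈ B ∧ v ∈ B) ∨ ∃ τ ∈ new, u ∈ τ.1 ∧ v ∈ τ.1) :
    RSInv E k S₀ ⟨new ++ rest, st.par ++ [p], st.bags ++ [B], ok⟩ := by
  have hτ : (S, W, p) ∈ st.work := hw ▸ List.mem_cons_self
  have hrest : ∀ τ ∈ rest, τ ∈ st.work := fun τ hτ' => hw ▸ List.mem_cons_of_mem _ hτ'
  have hSS₀ : ∀ v ∈ S, v ∈ S₀ := h.task_sub _ hτ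
  have hlen := h.length_par
  -- the rest of the work when there is no bag yet
  have hrest0 : st.bags = [] → rest = [] := fun h0 => by
    have := h.init_shape h0; rw [hw] at this; simpa using this
  refine ⟨by simp [hlen], ?_, ?_, ?_, ?_, ?_, ?_, ?_, ?_, ?_, ?_, ?_, ?_, ?_, ?_, ?_, ?_, ?_, by simp⟩
  · -- par_lt
    intro t h0 ht
    simp only [List.length_append, List.length_singleton] at ht
    rcases Nat.lt_or_ge t st.bags.length with hlt | hge
    · rw [parOf_append_of_lt (hlen ▸ hlt)]; exact h.par_lt t h0 hlt
    · have hteq : t = st.bags.length := by omega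
      subst hteq
      rw [← hlen, parOf_append_length]
      exact hlen ▸ h.task_par _ hτ (fun h0' => by rw [h0'] at h0; simp at h0)
  · -- bag_sub
    intro t v hv
    rcases mem_bagOf_append hv with ⟨-, hv⟩ | ⟨-, hv⟩
    · exact h.bag_sub t v hv
    · exact hSS₀ v (hBS v hv)
  · -- bag_nodup
    intro t
    rcases Nat.lt_trichotomy t st.bags.length with ht | rfl | ht
    · rw [bagOf_append_of_lt ht]; exact h.bag_nodup t
    · rwa [bagOf_append_length]
    · rw [bagOf_eq_nil (by simp; omega)]; exact List.nodup_nil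
  · -- bag_len
    intro t
    rcases Nat.lt_trichotomy t st.bags.length with ht | rfl | ht
    · rw [bagOf_append_of_lt ht]; exact h.bag_len t
    · rwa [bagOf_append_length]
    · rw [bagOf_eq_nil (by simp; omega)]; exact Nat.zero_le _
  · -- rooted
    intro v s t hst ht hvt hvs
    simp only [List.length_append, List.length_singleton] at ht
    have hs : s < st.bags.length := by omega
    rw [bagOf_append_of_lt hs] at hvs
    rcases Nat.lt_or_ge t st.bags.length with hlt | hge
    · rw [bagOf_append_of_lt hlt] at hvt
      rw [parOf_append_of_lt (hlen ▸ hlt), bagOf_append_of_lt ((h.par_lt t (by omega) hlt).trans hlt)]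
      exact h.rooted v s t hst hlt hvt hvs
    · have hteq : t = st.bags.length := by omega
      subst hteq
      rw [bagOf_append_length] at hvt
      rw [← hlen, parOf_append_length]
      have hne : st.bags ≠ [] := fun h0 => by rw [h0] at hs; simp at hs
      have hp : p < st.bags.length := h.task_par _ hτ hne
      rw [bagOf_append_of_lt hp]
      -- `v` is not free in the task (it is in the old bag `s`), hence in `W`, hence in bag `p`
      by_cases hvW : v ∈ W
      · exact h.taskW_bag _ hτ v hvW
      · exact absurd hvs (h.fresh _ hτ v ⟨hBS v hvt, hvW⟩ s hs)
  · -- cover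
    intro v hv
    rcases h.cover v hv with ⟨t, ht, hvt⟩ | ⟨τ, hτw, hvτ⟩
    · exact Or.inl ⟨t, by simp; omega, by rwa [bagOf_append_of_lt ht]⟩
    · rw [hw] at hτw
      rcases List.mem_cons.1 hτw with rfl | hτr
      · rcases hcov v hvτ with hvB | ⟨τ', hτ', hvτ'⟩
        · exact Or.inl ⟨st.bags.length, by simp, by rwa [bagOf_append_length]⟩
        · exact Or.inr ⟨τ', List.mem_append_left _ hτ', hvτ'⟩
      · exact Or.inr ⟨τ, List.mem_append_right _ hτr, hvτ⟩
  · -- coverE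
    intro u hu v hv huv
    rcases h.coverE u hu v hv huv with ⟨t, ht, hut, hvt⟩ | ⟨τ, hτw, huτ, hvτ⟩
    · exact Or.inl ⟨t, by simp; omega, by rwa [bagOf_append_of_lt ht], by rwa [bagOf_append_of_lt ht]⟩
    · rw [hw] at hτw
      rcases List.mem_cons.1 hτw with rfl | hτr
      · rcases hcovE u huτ v hvτ huv with ⟨huB, hvB⟩ | ⟨τ', hτ', huτ', hvτ'⟩
        · exact Or.inl ⟨st.bags.length, by simp, by rwa [bagOf_append_length], by rwa [bagOf_append_length]⟩
        · exact Or.inr ⟨τ', List.mem_append_left _ hτ', huτ', hvτ'⟩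
      · exact Or.inr ⟨τ, List.mem_append_right _ hτr, huτ, hvτ⟩
  · -- task_nodup
    intro τ hτ'
    rcases List.mem_append.1 hτ' with h' | h'
    · exact hnew_nd τ h'
    · exact h.task_nodup τ (hrest τ h')
  · intro τ hτ'
    rcases List.mem_append.1 hτ' with h' | h'
    · exact hnewW_nd τ h'
    · exact h.taskW_nodup τ (hrest τ h')
  · intro τ hτ'
    rcases List.mem_append.1 hτ' with h' | h'
    · exact hnewW_sub τ h'
    · exact h.taskW_sub τ (hrest τ h')
  · intro τ hτ'
    rcases List.mem_append.1 hτ' with h' | h'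
    · exact hnewW_len τ h'
    · exact h.taskW_len τ (hrest τ h')
  · intro τ hτ'
    rcases List.mem_append.1 hτ' with h' | h'
    · exact fun v hv => hSS₀ v (hnewS τ h' v hv)
    · exact h.task_sub τ (hrest τ h')
  · -- task_par
    intro τ hτ' _
    simp only [List.length_append, List.length_singleton]
    rcases List.mem_append.1 hτ' with h' | h'
    · rw [hnew_par τ h']; exact Nat.lt_succ_self _
    · by_cases h0 : st.bags = []
      · rw [hrest0 h0] at h'; simp at h'
      · exact (h.task_par τ (hrest τ h') h0).trans (Nat.lt_succ_self _)
  · -- init_shape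
    intro h0; simp at h0
  · -- taskW_bag
    intro τ hτ' v hv
    rcases List.mem_append.1 hτ' with h' | h'
    · rw [hnew_par τ h', bagOf_append_length]; exact hnewW_B τ h' v hv
    · by_cases h0 : st.bags = []
      · rw [hrest0 h0] at h'; simp at h'
      · rw [bagOf_append_of_lt (h.task_par τ (hrest τ h') h0)]
        exact h.taskW_bag τ (hrest τ h') v hv
  · -- fresh
    intro τ hτ' v hfree t ht
    simp only [List.length_append, List.length_singleton] at ht
    rcases List.mem_append.1 hτ' with h' | h'
    · obtain ⟨hfreeτ, hvB⟩ := hnew_free τ h' v hfree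
      rcases Nat.lt_or_ge t st.bags.length with hlt | hge
      · rw [bagOf_append_of_lt hlt]; exact h.fresh _ hτ v hfreeτ t hlt
      · have hteq : t = st.bags.length := by omega
        subst hteq; rwa [bagOf_append_length]
    · rcases Nat.lt_or_ge t st.bags.length with hlt | hge
      · rw [bagOf_append_of_lt hlt]; exact h.fresh τ (hrest τ h') v hfree t hlt
      · have hteq : t = st.bags.length := by omega
        subst hteq; rw [bagOf_append_length]
        intro hvB
        -- `v ∈ B ⊆ S`: free in the emitted task contradicts disjointness, in `W` contradicts freshness
        by_cases hvW : v ∈ W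
        · by_cases h0 : st.bags = []
          · rw [hrest0 h0] at h'; simp at h'
          · exact h.fresh τ (hrest τ h') v hfree p (h.task_par _ hτ h0) (h.taskW_bag _ hτ v hvW)
        · have hd := h.disj
          rw [hw, List.pairwise_cons] at hd
          exact hd.1 τ h' v ⟨hBS v hvB, hvW⟩ hfree
  · -- disj
    rw [List.pairwise_append]
    refine ⟨hnew_disj, ?_, ?_⟩
    · have hd := h.disj
      rw [hw, List.pairwise_cons] at hd
      exact hd.2
    · intro τ hτn τ' hτr v hf hf'
      have hd := h.disj
      rw [hw, List.pairwise_cons] at hd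
      exact hd.1 τ' hτr v (hnew_free τ hτn v hf).1 hf'

end Invariant

/-! ### One step preserves the invariant -/

section Step

variable {E : ℕ → ℕ → Prop} {k : ℕ} {S₀ : List ℕ} {oracle : List ℕ → List (ℕ × ℕ) → Option (List ℕ)}

/-- The success flag only ever goes down. [folklore] -/
theorem ok_of_ok_rsStep {st : RSState} (h : (rsStep oracle k st).ok = true) : st.ok = true := by
  unfold rsStep at h
  rcases hw : st.work with _ | ⟨⟨S, W, p⟩, rest⟩
  · rw [hw] at h; exact h
  · rw [hw] at h
    simp only at h
    split_ifs at h with hall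
    · exact h
    · rcases hfs : findSep oracle k S (pad k S W) with _ | lab
      · rw [hfs] at h; simp at h
      · rw [hfs] at h; exact h

/-- On an empty worklist nothing happens. [folklore] -/
theorem rsStep_of_work_nil {st : RSState} (hw : st.work = []) : rsStep oracle k st = st := by
  unfold rsStep; rw [hw]

/-- **What a sound oracle returns at a split**: the facts used by the step. [folklore] -/
theorem findSep_sound (hor : OracleSound E k S₀ oracle) {S W' lab : List ℕ} (hS : S.Nodup)
    (hSS₀ : ∀ v ∈ S, v ∈ S₀) (hW'S : ∀ v ∈ W', v ∈ S) (h : findSep oracle k S W' = some lab) :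
    lab.length = S.length ∧ (∀ x ∈ lab, x ≤ 2) ∧ (side S lab 1).length ≤ k + 1 ∧
    (∀ u ∈ S, ∀ v ∈ S, E u v → labelOf S lab u = 0 → labelOf S lab v ≠ 2) ∧
    (W'.filter fun v => decide (labelOf S lab v = 0)).length ≤ 2 * k + 2 ∧
    (W'.filter fun v => decide (labelOf S lab v = 2)).length ≤ 2 * k + 2 := by
  obtain ⟨c, hc, hoc⟩ := List.exists_of_findSome?_eq_some h
  obtain ⟨hcA, hc0, hc2⟩ := mem_candidates.1 hc
  obtain ⟨hlen, hlab, hforced, hside, hedge⟩ := hor S (W'.zip c) lab hS hSS₀ hoc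
  have hclen : c.length = W'.length := (mem_allAssign.1 hcA).1
  have hf : ∀ (i : ℕ) (hi : i < W'.length) (hi' : i < c.length), labelOf S lab W'[i] = c[i] := by
    intro i hi hi'
    have hmem : (W'[i], c[i]) ∈ W'.zip c := by
      have hiz : i < (W'.zip c).length := by simp [hi, hi']
      have := List.getElem_mem hiz
      rwa [List.getElem_zip] at this
    exact hforced _ hmem (hW'S _ (List.getElem_mem hi))
  refine ⟨hlen, hlab, hside, hedge, ?_, ?_⟩
  · rw [length_filter_label_eq_count _ 0 W' c hclen hf]; exact hc0
  · rw [length_filter_label_eq_count _ 2 W' c hclen hf]; exact hc2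

/-- **The state after a leaf step.** [folklore] -/
theorem rsStep_eq_leaf {st : RSState} {S W : List ℕ} {p : ℕ} {rest : List (List ℕ × List ℕ × ℕ)}
    (hw : st.work = (S, W, p) :: rest) (hall : (S.all fun v => decide (v ∈ pad k S W)) = true) :
    rsStep oracle k st = ⟨[] ++ rest, st.par ++ [p], st.bags ++ [pad k S W], st.ok⟩ := by
  unfold rsStep; rw [hw]; simp only [hall, if_true, List.nil_append]

/-- **The state after a successful split step**, over a sound oracle (the caps are no-ops): the
bag `pad W ∪ X` is emitted and the two sides are pushed, `X` the separator vertices.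
[cite: CyganEtAl2015, Thm 7.18 (proof)] -/
theorem rsStep_eq_split (hor : OracleSound E k S₀ oracle) {st : RSState} {S W : List ℕ} {p : ℕ}
    {rest : List (List ℕ × List ℕ × ℕ)} (hw : st.work = (S, W, p) :: rest) (hS : S.Nodup)
    (hSS₀ : ∀ v ∈ S, v ∈ S₀) (hWS : ∀ v ∈ W, v ∈ S)
    (hall : ¬ (S.all fun v => decide (v ∈ pad k S W)) = true) {lab : List ℕ}
    (hfs : findSep oracle k S (pad k S W) = some lab) :
    rsStep oracle k st =
      ⟨[(side S lab 0 ++ side S lab 1,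
          ((pad k S W).filter fun v => decide (labelOf S lab v = 0)) ++ side S lab 1, st.bags.length),
        (side S lab 2 ++ side S lab 1,
          ((pad k S W).filter fun v => decide (labelOf S lab v = 2)) ++ side S lab 1, st.bags.length)] ++ rest,
       st.par ++ [p],
       st.bags ++ [pad k S W ++ (side S lab 1).filter fun v => decide (v ∉ pad k S W)], st.ok⟩ := by
  obtain ⟨-, -, hside, -, hc0, hc2⟩ := findSep_sound hor hS hSS₀ (pad_subset hWS) hfs
  have hXcap : (side S lab 1).take (k + 1) = side S lab 1 := List.take_of_length_le hside
  have hW0cap : ((pad k S W).filter fun v => decide (labelOf S lab v = 0)).take (2 * k + 2) =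
      (pad k S W).filter fun v => decide (labelOf S lab v = 0) := List.take_of_length_le hc0
  have hW2cap : ((pad k S W).filter fun v => decide (labelOf S lab v = 2)).take (2 * k + 2) =
      (pad k S W).filter fun v => decide (labelOf S lab v = 2) := List.take_of_length_le hc2
  unfold rsStep; rw [hw]
  simp only [hall]
  rw [hfs]
  simp only [hXcap, hW0cap, hW2cap, Bool.false_eq_true, if_false]
  rfl

/-- **The step preserves the invariant** (over a sound oracle and a symmetric edge relation), as
long as it does not fail. [cite: CyganEtAl2015, Thm 7.18 (proof)] -/
theorem rsInv_step (hE : ∀ u v, E u v → E v u) (hor : OracleSound E k S₀ oracle) {st : RSState}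
    (h : RSInv E k S₀ st) (hok : (rsStep oracle k st).ok = true) : RSInv E k S₀ (rsStep oracle k st) := by
  rcases hw : st.work with _ | ⟨⟨S, W, p⟩, rest⟩
  · rw [rsStep_of_work_nil hw]; exact h
  have hτ : (S, W, p) ∈ st.work := hw ▸ List.mem_cons_self
  have hWS : ∀ v ∈ W, v ∈ S := h.taskW_sub _ hτ
  have hSnd : S.Nodup := h.task_nodup _ hτ
  have hWnd : W.Nodup := h.taskW_nodup _ hτ
  have hWlen : W.length ≤ 3 * k + 3 := h.taskW_len _ hτ
  set W' := pad k S W with hW'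
  have hW'S : ∀ v ∈ W', v ∈ S := pad_subset hWS
  have hW'nd : W'.Nodup := nodup_pad hSnd hWnd
  have hW'len : W'.length ≤ 3 * k + 4 := length_pad_le (by omega)
  have hWW' : ∀ v ∈ W, v ∈ W' := subset_pad k S W
  by_cases hall : (S.all fun v => decide (v ∈ W')) = true
  · -- leaf
    rw [rsStep_eq_leaf hw hall]
    have hcov : ∀ v ∈ S, v ∈ W' := fun v hv => by
      have := List.all_eq_true.1 hall v hv; simpa using this
    refine rsInv_emit h hw W' [] st.ok hW'S hW'nd (by omega) ?_ ?_ ?_ ?_ ?_ ?_ ?_ ?_ (by simp)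
      (fun v hv => Or.inl (hcov v hv)) (fun u hu v hv _ => Or.inl ⟨hcov u hu, hcov v hv⟩)
    all_goals intro τ hτ'; simp at hτ'
  · -- split
    rcases hfs : findSep oracle k S W' with _ | lab
    · -- failure contradicts `hok`
      exfalso
      unfold rsStep at hok; rw [hw] at hok
      simp only [← hW', hall] at hok
      rw [hfs] at hok
      simp at hok
    have hSS₀ : ∀ v ∈ S, v ∈ S₀ := h.task_sub _ hτ
    obtain ⟨hlen, hlab, hside, hedge, hc0, hc2⟩ := findSep_sound hor hSnd hSS₀ hW'S hfs
    -- the caps are no-ops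
    set X := side S lab 1 with hX
    set W0 := W'.filter fun v => decide (labelOf S lab v = 0) with hW0
    set W2 := W'.filter fun v => decide (labelOf S lab v = 2) with hW2
    set B := W' ++ X.filter fun v => decide (v ∉ W') with hB
    set τ₁ : List ℕ × List ℕ × ℕ := (side S lab 0 ++ X, W0 ++ X, st.bags.length) with hτ₁
    set τ₂ : List ℕ × List ℕ × ℕ := (side S lab 2 ++ X, W2 ++ X, st.bags.length) with hτ₂
    have hstep : rsStep oracle k st = ⟨[τ₁, τ₂] ++ rest, st.par ++ [p], st.bags ++ [B], st.ok⟩ :=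
      rsStep_eq_split hor hw hSnd hSS₀ hWS hall hfs
    rw [hstep]
    -- facts on labels
    have hl2 : ∀ v ∈ S, labelOf S lab v ≤ 2 := fun v hv => labelOf_le_two hlen hlab hv
    have hXS : ∀ v ∈ X, v ∈ S := fun v hv => (mem_side.1 hv).1
    have hX1 : ∀ v ∈ X, labelOf S lab v = 1 := fun v hv => (mem_side.1 hv).2
    have hXnd : X.Nodup := nodup_side hSnd 1
    have hBS : ∀ v ∈ B, v ∈ S := fun v hv => by
      rcases List.mem_append.1 hv with hv | hv
      · exact hW'S v hv
      · exact hXS v (List.mem_of_mem_filter hv)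
    have hXB : ∀ v ∈ X, v ∈ B := fun v hv => by
      by_cases hvW' : v ∈ W'
      · exact List.mem_append_left _ hvW'
      · exact List.mem_append_right _ (List.mem_filter.2 ⟨hv, by simpa using hvW'⟩)
    have hW0W' : ∀ v ∈ W0, v ∈ W' := fun v hv => List.mem_of_mem_filter hv
    have hW2W' : ∀ v ∈ W2, v ∈ W' := fun v hv => List.mem_of_mem_filter hv
    have hW0l : ∀ v ∈ W0, labelOf S lab v = 0 := fun v hv => by simpa using (List.mem_filter.1 hv).2
    have hW2l : ∀ v ∈ W2, labelOf S lab v = 2 := fun v hv => by simpa using (List.mem_filter.1 hv).2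
    -- the free vertices of the two new tasks
    have hfree₁ : ∀ v, Free τ₁ v → v ∈ S ∧ labelOf S lab v = 0 ∧ v ∉ W' := by
      rintro v ⟨hv, hvW⟩
      simp only [hτ₁, List.mem_append, not_or] at hv hvW
      have hvX : v ∉ X := hvW.2
      have hv0 := mem_side.1 (hv.resolve_right hvX)
      exact ⟨hv0.1, hv0.2, fun hvW' => hvW.1 (List.mem_filter.2 ⟨hvW', by simpa using hv0.2⟩)⟩
    have hfree₂ : ∀ v, Free τ₂ v → v ∈ S ∧ labelOf S lab v = 2 ∧ v ∉ W' := by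
      rintro v ⟨hv, hvW⟩
      simp only [hτ₂, List.mem_append, not_or] at hv hvW
      have hvX : v ∉ X := hvW.2
      have hv2 := mem_side.1 (hv.resolve_right hvX)
      exact ⟨hv2.1, hv2.2, fun hvW' => hvW.1 (List.mem_filter.2 ⟨hvW', by simpa using hv2.2⟩)⟩
    -- where a vertex of `S` goes, by label
    have hgo : ∀ v ∈ S, (labelOf S lab v = 0 ∧ v ∈ τ₁.1) ∨ (labelOf S lab v = 1 ∧ v ∈ B ∧ v ∈ τ₁.1 ∧ v ∈ τ₂.1) ∨
        (labelOf S lab v = 2 ∧ v ∈ τ₂.1) := by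
      intro v hv
      have h2 := hl2 v hv
      rcases (show labelOf S lab v = 0 ∨ labelOf S lab v = 1 ∨ labelOf S lab v = 2 by omega) with hlv | hlv | hlv
      · exact Or.inl ⟨hlv, List.mem_append_left _ (mem_side.2 ⟨hv, hlv⟩)⟩
      · have hvX : v ∈ X := mem_side.2 ⟨hv, hlv⟩
        exact Or.inr (Or.inl ⟨hlv, hXB v hvX, List.mem_append_right _ hvX, List.mem_append_right _ hvX⟩)
      · exact Or.inr (Or.inr ⟨hlv, List.mem_append_left _ (mem_side.2 ⟨hv, hlv⟩)⟩)
    refine rsInv_emit h hw B [τ₁, τ₂] st.ok hBS ?_ ?_ ?_ ?_ ?_ ?_ ?_ ?_ ?_ ?_ ?_ ?_ ?_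
    · -- B nodup
      refine List.Nodup.append hW'nd (hXnd.filter _) fun v hvW' hv => ?_
      have := (List.mem_filter.1 hv).2; simp at this; exact this hvW'
    · -- |B| ≤ 4k+5
      rw [List.length_append]
      have := List.length_filter_le (fun v => decide (v ∉ W')) X
      omega
    · -- new tasks inside S
      intro τ hτ' v hv
      simp only [List.mem_cons, List.not_mem_nil, or_false] at hτ'
      rcases hτ' with rfl | rfl
      · simp only [hτ₁, List.mem_append] at hv
        rcases hv with hv | hv; exact (mem_side.1 hv).1; exact hXS v hv
      · simp only [hτ₂, List.mem_append] at hv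
        rcases hv with hv | hv; exact (mem_side.1 hv).1; exact hXS v hv
    · -- new S nodup
      intro τ hτ'
      simp only [List.mem_cons, List.not_mem_nil, or_false] at hτ'
      rcases hτ' with rfl | rfl
      · refine List.Nodup.append (nodup_side hSnd 0) hXnd fun v hv0 hvX => ?_
        have := (mem_side.1 hv0).2; rw [hX1 v hvX] at this; exact absurd this (by decide)
      · refine List.Nodup.append (nodup_side hSnd 2) hXnd fun v hv2 hvX => ?_
        have := (mem_side.1 hv2).2; rw [hX1 v hvX] at this; exact absurd this (by decide)
    · -- new W nodup
      intro τ hτ'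
      simp only [List.mem_cons, List.not_mem_nil, or_false] at hτ'
      rcases hτ' with rfl | rfl
      · refine List.Nodup.append (hW'nd.filter _) hXnd fun v hv0 hvX => ?_
        have := hW0l v hv0; rw [hX1 v hvX] at this; exact absurd this (by decide)
      · refine List.Nodup.append (hW'nd.filter _) hXnd fun v hv2 hvX => ?_
        have := hW2l v hv2; rw [hX1 v hvX] at this; exact absurd this (by decide)
    · -- W ⊆ S in new tasks
      intro τ hτ' v hv
      simp only [List.mem_cons, List.not_mem_nil, or_false] at hτ'
      rcases hτ' with rfl | rfl
      · simp only [hτ₁, List.mem_append] at hv ⊢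
        rcases hv with hv | hv
        · exact Or.inl (mem_side.2 ⟨hW'S v (hW0W' v hv), hW0l v hv⟩)
        · exact Or.inr hv
      · simp only [hτ₂, List.mem_append] at hv ⊢
        rcases hv with hv | hv
        · exact Or.inl (mem_side.2 ⟨hW'S v (hW2W' v hv), hW2l v hv⟩)
        · exact Or.inr hv
    · -- |W| ≤ 3k+3 in new tasks
      intro τ hτ'
      simp only [List.mem_cons, List.not_mem_nil, or_false] at hτ'
      rcases hτ' with rfl | rfl
      · simp only [hτ₁, List.length_append]; omega
      · simp only [hτ₂, List.length_append]; omega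
    · -- parents of new tasks
      intro τ hτ'
      simp only [List.mem_cons, List.not_mem_nil, or_false] at hτ'
      rcases hτ' with rfl | rfl
      · simp only [hτ₁]
      · simp only [hτ₂]
    · -- W ⊆ B in new tasks
      intro τ hτ' v hv
      simp only [List.mem_cons, List.not_mem_nil, or_false] at hτ'
      rcases hτ' with rfl | rfl
      · simp only [hτ₁, List.mem_append] at hv
        rcases hv with hv | hv; exact List.mem_append_left _ (hW0W' v hv); exact hXB v hv
      · simp only [hτ₂, List.mem_append] at hv
        rcases hv with hv | hv; exact List.mem_append_left _ (hW2W' v hv); exact hXB v hv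
    · -- free vertices of new tasks are free in the old task and outside B
      intro τ hτ' v hfree
      simp only [List.mem_cons, List.not_mem_nil, or_false] at hτ'
      have key : ∀ a, (v ∈ S ∧ labelOf S lab v = a ∧ v ∉ W') → a ≠ 1 → Free (S, W, p) v ∧ v ∉ B := by
        rintro a ⟨hvS, hva, hvW'⟩ ha
        refine ⟨⟨hvS, fun hvW => hvW' (hWW' v hvW)⟩, fun hvB => ?_⟩
        rcases List.mem_append.1 hvB with hvB | hvB
        · exact hvW' hvB
        · exact ha (hva ▸ (hX1 v (List.mem_of_mem_filter hvB)).symm).symm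
      rcases hτ' with rfl | rfl
      · exact key 0 (hfree₁ v hfree) (by decide)
      · exact key 2 (hfree₂ v hfree) (by decide)
    · -- the two new tasks have disjoint free vertices
      refine List.pairwise_pair.2 fun v hf₁ hf₂ => ?_
      have h0 := (hfree₁ v hf₁).2.1
      have h2 := (hfree₂ v hf₂).2.1
      rw [h0] at h2; exact absurd h2 (by decide)
    · -- coverage of S
      intro v hv
      rcases hgo v hv with ⟨-, h1⟩ | ⟨-, hB', -⟩ | ⟨-, h2⟩
      · exact Or.inr ⟨τ₁, by simp, h1⟩
      · exact Or.inl hB'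
      · exact Or.inr ⟨τ₂, by simp, h2⟩
    · -- coverage of the edges of S
      intro u hu v hv huv
      have hne02 : labelOf S lab u = 0 → labelOf S lab v ≠ 2 := hedge u hu v hv huv
      have hne20 : labelOf S lab v = 0 → labelOf S lab u ≠ 2 := hedge v hv u hu (hE _ _ huv)
      rcases hgo u hu with ⟨hu0, hu1⟩ | ⟨-, -, hu1, hu2⟩ | ⟨hu2l, hu2⟩ <;>
        rcases hgo v hv with ⟨hv0, hv1⟩ | ⟨-, -, hv1, hv2⟩ | ⟨hv2l, hv2⟩
      · exact Or.inr ⟨τ₁, by simp, hu1, hv1⟩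
      · exact Or.inr ⟨τ₁, by simp, hu1, hv1⟩
      · exact absurd hv2l (hne02 hu0)
      · exact Or.inr ⟨τ₁, by simp, hu1, hv1⟩
      · exact Or.inr ⟨τ₁, by simp, hu1, hv1⟩
      · exact Or.inr ⟨τ₂, by simp, hu2, hv2⟩
      · exact absurd hu2l (hne20 hv0)
      · exact Or.inr ⟨τ₂, by simp, hu2, hv2⟩
      · exact Or.inr ⟨τ₂, by simp, hu2, hv2⟩

/-- The invariant along the run, as long as no failure occurred. [folklore] -/
theorem rsInv_iterate (hE : ∀ u v, E u v → E v u) (hor : OracleSound E k S₀ oracle) (hS₀ : S₀.Nodup) :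
    ∀ n, ((rsStep oracle k)^[n] (rsInit S₀)).ok = true → RSInv E k S₀ ((rsStep oracle k)^[n] (rsInit S₀))
  | 0, _ => rsInv_init hS₀
  | n + 1, hok => by
    rw [Function.iterate_succ_apply'] at hok ⊢
    exact rsInv_step hE hor (rsInv_iterate hE hor hS₀ n (ok_of_ok_rsStep hok)) hok

/-- **Validity of the output** (Cygan et al., Thm. 7.18, first half: "outputs a tree decomposition
of width at most `4k + 4`"): over a sound oracle, a successful run on `S₀` outputs a rooted tree
decomposition of `S₀` covering the edges of `E` inside `S₀`, with all bags of size `≤ 4k + 5`.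
[cite: CyganEtAl2015, Thm 7.18] -/
theorem isRootedTDOn_rsResult (hE : ∀ u v, E u v → E v u) (hor : OracleSound E k S₀ oracle) (hS₀ : S₀.Nodup)
    {fuel : ℕ} {par : List ℕ} {bags : List (List ℕ)} (h : rsResult oracle k S₀ fuel = some (par, bags)) :
    IsRootedTDOn S₀.toFinset par bags ∧ CoversEdges S₀.toFinset E bags ∧ ∀ t, (bagOf bags t).length ≤ 4 * k + 5 := by
  unfold rsResult at h
  split_ifs at h with hc
  obtain ⟨hwork, hok⟩ := hc
  simp only [Option.some.injEq, Prod.mk.injEq] at h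
  obtain ⟨rfl, rfl⟩ := h
  have hI := rsInv_iterate hE hor hS₀ fuel hok
  set st := (rsStep oracle k)^[fuel] (rsInit S₀) with hst
  have hw : st.work = [] := List.isEmpty_iff.1 hwork
  have hpos : 0 < st.bags.length := by
    rcases hI.work_or_bags with h' | h'
    · exact absurd hw h'
    · exact List.length_pos_iff.2 h'
  refine ⟨⟨hI.length_par, hpos, hI.par_lt, fun t v hv => List.mem_toFinset.2 (hI.bag_sub t v hv), hI.bag_nodup,
    fun v hv => ?_, hI.rooted⟩, fun u hu v hv huv => ?_, hI.bag_len⟩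
  · rcases hI.cover v (List.mem_toFinset.1 hv) with h' | ⟨τ, hτ, -⟩
    · exact h'
    · rw [hw] at hτ; simp at hτ
  · rcases hI.coverE u (List.mem_toFinset.1 hu) v (List.mem_toFinset.1 hv) huv with h' | ⟨τ, hτ, -⟩
    · exact h'
    · rw [hw] at hτ; simp at hτ

end Step

/-! ### Completeness: no failure, and enough fuel, when a small decomposition exists -/

section Completeness

variable {E : ℕ → ℕ → Prop} {k : ℕ} {S₀ : List ℕ} {oracle : List ℕ → List (ℕ × ℕ) → Option (List ℕ)}

/-- Counting a `Fin 3`-valued label along a list without repetition. [folklore] -/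
theorem count_map_fin_val (ℓ : ℕ → Fin 3) {W : List ℕ} (hW : W.Nodup) (a : Fin 3) :
    (W.map fun v => ((ℓ v : Fin 3) : ℕ)).count (a : ℕ) = (W.toFinset.filter fun v => ℓ v = a).card := by
  rw [List.count_eq_length_filter, List.filter_map, List.length_map, ← List.toFinset_card_of_nodup (hW.filter _),
    List.toFinset_filter]
  congr 1
  ext v
  simp only [Finset.mem_filter, List.mem_toFinset, Function.comp_apply, beq_iff_eq, and_congr_right_iff]
  intro _
  exact Fin.val_inj

/-- **At a split a good candidate exists** (Cygan et al., Thm. 7.18, the "tw ≤ k" branch): if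
`S₀` has a rooted decomposition covering its edges with bags of size `≤ k + 1`, then for every
`S ⊆ S₀` and `W' ⊆ S` with `|W'| = 3k + 4` the separator search succeeds over a complete oracle.
[cite: CyganEtAl2015, Thm 7.18 (proof) and Cor 7.21] -/
theorem findSep_ne_none (hE : ∀ u v, E u v → E v u) (hoc : OracleComplete E k S₀ oracle)
    (hex : ∃ par bags, IsRootedTDOn S₀.toFinset par bags ∧ CoversEdges S₀.toFinset E bags ∧
      ∀ t, t < bags.length → (bagOf bags t).length ≤ k + 1)
    {S W' : List ℕ} (hS : S.Nodup) (hSS₀ : ∀ v ∈ S, v ∈ S₀) (hW' : W'.Nodup) (hW'S : ∀ v ∈ W', v ∈ S)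
    (hW'len : W'.length = 3 * k + 4) : findSep oracle k S W' ≠ none := by
  classical
  obtain ⟨par, bags, hD, hT2, hk⟩ := hex
  have hsub : S.toFinset ⊆ S₀.toFinset := fun v hv => List.mem_toFinset.2 (hSS₀ v (List.mem_toFinset.1 hv))
  have hD' := hD.induce hsub
  have hT2' := hT2.induce hsub
  have hk' : ∀ t, t < (bags.map fun B => B.filter fun v => decide (v ∈ S.toFinset)).length →
      (bagOf (bags.map fun B => B.filter fun v => decide (v ∈ S.toFinset)) t).length ≤ k + 1 := by
    intro t ht
    rw [bagOf_map_filter]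
    exact (List.length_filter_le _ _).trans (hk t (by simpa using ht))
  have hWsub : W'.toFinset ⊆ S.toFinset := fun v hv => List.mem_toFinset.2 (hW'S v (List.mem_toFinset.1 hv))
  obtain ⟨ℓ, h02, h1, hb0, hb2⟩ := exists_balanced_labeling hD' hE hT2' hk' hWsub
  have hcardW : W'.toFinset.card = 3 * k + 4 := by rw [List.toFinset_card_of_nodup hW', hW'len]
  -- the candidate read off `ℓ`
  set c : List ℕ := W'.map fun v => ((ℓ v : Fin 3) : ℕ) with hc
  have hcA : c ∈ allAssign 3 W' := by
    refine mem_allAssign.2 ⟨by simp [hc], fun x hx => ?_⟩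
    obtain ⟨v, -, rfl⟩ := List.mem_map.1 hx
    exact (ℓ v).isLt
  have hcount : ∀ a : Fin 3, c.count (a : ℕ) = (W'.toFinset.filter fun v => ℓ v = a).card :=
    fun a => count_map_fin_val ℓ hW' a
  have hcand : c ∈ candidates k W' := by
    refine mem_candidates.2 ⟨hcA, ?_, ?_⟩
    · have := hcount 0; simp only [Fin.val_zero] at this; rw [this]; omega
    · have := hcount 2; rw [show ((2 : Fin 3) : ℕ) = 2 from rfl] at this; rw [this]; omega
  -- the oracle answers on it
  have hsome : (oracle S (W'.zip c)).isSome = true := by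
    refine hoc S (W'.zip c) hS hSS₀ (fun q hq => hW'S _ (List.of_mem_zip hq).1)
      ⟨fun v => ((ℓ v : Fin 3) : ℕ), ?_, ?_, ?_, ?_⟩
    · intro q hq
      obtain ⟨i, hi, hiq⟩ := List.mem_iff_getElem.1 hq
      rw [List.getElem_zip] at hiq
      rw [← hiq]
      simp [hc]
    · intro v; exact Nat.le_of_lt_succ (ℓ v).isLt
    · rw [← List.toFinset_card_of_nodup (hS.filter _), List.toFinset_filter]
      convert h1 using 2
      ext v
      simp only [Finset.mem_filter, List.mem_toFinset, decide_eq_true_eq, and_congr_right_iff]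
      intro _
      rw [Fin.ext_iff]; rfl
    · intro u hu v hv huv hu0 hv2
      refine h02 u (List.mem_toFinset.2 hu) v (List.mem_toFinset.2 hv) huv ?_ ?_
      · exact Fin.ext hu0
      · exact Fin.ext hv2
  intro hnone
  rw [findSep, List.findSome?_eq_none_iff] at hnone
  have := hnone c hcand
  rw [this] at hsome
  simp at hsome

/-- **The step does not fail** when a small decomposition of `S₀` exists (sound and complete
oracle). [cite: CyganEtAl2015, Thm 7.18 (proof)] -/
theorem ok_rsStep (hE : ∀ u v, E u v → E v u) (hoc : OracleComplete E k S₀ oracle)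
    (hex : ∃ par bags, IsRootedTDOn S₀.toFinset par bags ∧ CoversEdges S₀.toFinset E bags ∧
      ∀ t, t < bags.length → (bagOf bags t).length ≤ k + 1)
    {st : RSState} (hI : RSInv E k S₀ st) (hok : st.ok = true) : (rsStep oracle k st).ok = true := by
  rcases hw : st.work with _ | ⟨⟨S, W, p⟩, rest⟩
  · rw [rsStep_of_work_nil hw]; exact hok
  have hτ : (S, W, p) ∈ st.work := hw ▸ List.mem_cons_self
  have hWS : ∀ v ∈ W, v ∈ S := hI.taskW_sub _ hτ
  by_cases hall : (S.all fun v => decide (v ∈ pad k S W)) = true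
  · rw [rsStep_eq_leaf hw hall]; exact hok
  · have hne := findSep_ne_none (S₀ := S₀) hE hoc hex (hI.task_nodup _ hτ) (hI.task_sub _ hτ)
      (nodup_pad (hI.task_nodup _ hτ) (hI.taskW_nodup _ hτ)) (pad_subset hWS)
      (length_pad_eq (by have := hI.taskW_len _ hτ; omega) fun h => hall (List.all_eq_true.2 fun v hv => by
        simpa using h v hv))
    obtain ⟨lab, hfs⟩ := Option.ne_none_iff_exists'.1 hne
    unfold rsStep; rw [hw]
    simp only [hall]
    rw [hfs]
    exact hok

/-- **The potential of a task** `(S, W, p)`: twice the number of free vertices, plus one. [folklore] -/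
noncomputable def taskPot (τ : List ℕ × List ℕ × ℕ) : ℕ := 2 * (τ.1.toFinset \ τ.2.1.toFinset).card + 1

/-- **The potential of a worklist.** [folklore] -/
noncomputable def pot (work : List (List ℕ × List ℕ × ℕ)) : ℕ := (work.map taskPot).sum

/-- The initial potential. [folklore] -/
theorem pot_rsInit (hS₀ : S₀.Nodup) : pot (rsInit S₀).work = 2 * S₀.length + 1 := by
  simp [pot, taskPot, rsInit, List.toFinset_card_of_nodup hS₀]

/-- **Every step on a nonempty worklist lowers the potential** (over a sound oracle, while no failure
occurs): a leaf task disappears; a split task is replaced by two tasks whose free vertices are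
disjoint subsets of its own free vertices, at least one of which (a padding vertex) became an
interface vertex. [cite: CyganEtAl2015, Thm 7.18 (proof: the recursion terminates)] -/
theorem pot_rsStep_lt (hor : OracleSound E k S₀ oracle) {st : RSState} (hI : RSInv E k S₀ st)
    (hw : st.work ≠ []) (hok : (rsStep oracle k st).ok = true) : pot (rsStep oracle k st).work < pot st.work := by
  classical
  rcases hw' : st.work with _ | ⟨⟨S, W, p⟩, rest⟩
  · exact absurd hw' hw
  have hτ : (S, W, p) ∈ st.work := hw' ▸ List.mem_cons_self
  have hWS : ∀ v ∈ W, v ∈ S := hI.taskW_sub _ hτ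
  have hSnd : S.Nodup := hI.task_nodup _ hτ
  have hWnd : W.Nodup := hI.taskW_nodup _ hτ
  have hWlen : W.length ≤ 3 * k + 3 := hI.taskW_len _ hτ
  have hpot : ∀ l : List (List ℕ × List ℕ × ℕ), pot ((S, W, p) :: l) = taskPot (S, W, p) + pot l := fun l => by
    simp [pot]
  have hpos : 1 ≤ taskPot (S, W, p) := by simp [taskPot]
  by_cases hall : (S.all fun v => decide (v ∈ pad k S W)) = true
  · rw [rsStep_eq_leaf hw' hall, hpot]
    show pot ([] ++ rest) < _
    rw [List.nil_append]
    omega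
  · rcases hfs : findSep oracle k S (pad k S W) with _ | lab
    · exfalso
      unfold rsStep at hok; rw [hw'] at hok
      simp only [hall] at hok
      rw [hfs] at hok
      simp at hok
    rw [rsStep_eq_split hor hw' hSnd (hI.task_sub _ hτ) hWS hall hfs, hpot]
    set W' := pad k S W with hW'
    set X := side S lab 1 with hX
    have hpot2 : ∀ (a b : List ℕ × List ℕ × ℕ) (l : List (List ℕ × List ℕ × ℕ)),
        pot ([a, b] ++ l) = taskPot a + taskPot b + pot l := fun a b l => by
      simp [pot, add_assoc]
    show pot ([_, _] ++ rest) < _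
    rw [hpot2]
    -- the free sets
    set F : Finset ℕ := S.toFinset \ W.toFinset with hF
    set F₁ : Finset ℕ := (side S lab 0 ++ X).toFinset \ ((W'.filter fun v => decide (labelOf S lab v = 0)) ++ X).toFinset
      with hF₁
    set F₂ : Finset ℕ := (side S lab 2 ++ X).toFinset \ ((W'.filter fun v => decide (labelOf S lab v = 2)) ++ X).toFinset
      with hF₂
    set D : Finset ℕ := S.toFinset \ W'.toFinset with hD
    set P : Finset ℕ := W'.toFinset \ W.toFinset with hP
    have hmem₁ : ∀ v ∈ F₁, v ∈ D ∧ labelOf S lab v = 0 := by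
      intro v hv
      simp only [hF₁, Finset.mem_sdiff, List.mem_toFinset, List.mem_append, not_or, List.mem_filter,
        decide_eq_true_eq, not_and] at hv
      obtain ⟨hv, hvW0, hvX⟩ := hv
      have hv0 := mem_side.1 (hv.resolve_right hvX)
      exact ⟨Finset.mem_sdiff.2 ⟨List.mem_toFinset.2 hv0.1, fun h => hvW0 (List.mem_toFinset.1 h) hv0.2⟩, hv0.2⟩
    have hmem₂ : ∀ v ∈ F₂, v ∈ D ∧ labelOf S lab v = 2 := by
      intro v hv
      simp only [hF₂, Finset.mem_sdiff, List.mem_toFinset, List.mem_append, not_or, List.mem_filter,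
        decide_eq_true_eq, not_and] at hv
      obtain ⟨hv, hvW2, hvX⟩ := hv
      have hv2 := mem_side.1 (hv.resolve_right hvX)
      exact ⟨Finset.mem_sdiff.2 ⟨List.mem_toFinset.2 hv2.1, fun h => hvW2 (List.mem_toFinset.1 h) hv2.2⟩, hv2.2⟩
    have hdisj : Disjoint F₁ F₂ := by
      rw [Finset.disjoint_left]
      intro v hv₁ hv₂
      have h0 := (hmem₁ v hv₁).2
      rw [(hmem₂ v hv₂).2] at h0
      exact absurd h0 (by decide)
    have h12 : (F₁ ∪ F₂) ⊆ D := Finset.union_subset (fun v hv => (hmem₁ v hv).1) fun v hv => (hmem₂ v hv).1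
    have hDP : Disjoint D P := by
      rw [Finset.disjoint_left]
      intro v hvD hvP
      exact (Finset.mem_sdiff.1 hvD).2 (Finset.mem_sdiff.1 hvP).1
    have hDPF : D ∪ P ⊆ F := by
      intro v hv
      rcases Finset.mem_union.1 hv with hv | hv
      · obtain ⟨hvS, hvW'⟩ := Finset.mem_sdiff.1 hv
        exact Finset.mem_sdiff.2 ⟨hvS, fun hvW => hvW' (List.mem_toFinset.2 (subset_pad k S W v (List.mem_toFinset.1 hvW)))⟩
      · obtain ⟨hvW', hvW⟩ := Finset.mem_sdiff.1 hv
        exact Finset.mem_sdiff.2 ⟨List.mem_toFinset.2 (pad_subset hWS v (List.mem_toFinset.1 hvW')), hvW⟩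
    -- at least one padding vertex
    have hPpos : 1 ≤ P.card := by
      have hW'len : W'.length = 3 * k + 4 := length_pad_eq (by omega) fun h =>
        hall (List.all_eq_true.2 fun v hv => by simpa using h v hv)
      have h1 : W'.toFinset.card = 3 * k + 4 := by
        rw [List.toFinset_card_of_nodup (nodup_pad hSnd hWnd), hW'len]
      have h2 : W.toFinset.card ≤ 3 * k + 3 := (List.toFinset_card_le W).trans hWlen
      have h3 := Finset.le_card_sdiff W.toFinset W'.toFinset
      rw [hP]
      omega
    have hcard : F₁.card + F₂.card + 1 ≤ F.card := by
      calc F₁.card + F₂.card + 1 = (F₁ ∪ F₂).card + 1 := by rw [Finset.card_union_of_disjoint hdisj]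
        _ ≤ D.card + P.card := Nat.add_le_add (Finset.card_le_card h12) hPpos
        _ = (D ∪ P).card := (Finset.card_union_of_disjoint hDP).symm
        _ ≤ F.card := Finset.card_le_card hDPF
    show 2 * F₁.card + 1 + (2 * F₂.card + 1) + pot rest < 2 * F.card + 1 + pot rest
    omega

/-- **The run never fails and finishes within the fuel `2|S₀| + 1`** (sound and complete oracle,
small decomposition exists). [cite: CyganEtAl2015, Thm 7.18] -/
theorem rsRun_ok_and_pot (hE : ∀ u v, E u v → E v u) (hor : OracleSound E k S₀ oracle) (hoc : OracleComplete E k S₀ oracle)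
    (hS₀ : S₀.Nodup)
    (hex : ∃ par bags, IsRootedTDOn S₀.toFinset par bags ∧ CoversEdges S₀.toFinset E bags ∧
      ∀ t, t < bags.length → (bagOf bags t).length ≤ k + 1) :
    ∀ n, ((rsStep oracle k)^[n] (rsInit S₀)).ok = true ∧
      (((rsStep oracle k)^[n] (rsInit S₀)).work ≠ [] → pot ((rsStep oracle k)^[n] (rsInit S₀)).work + n ≤ 2 * S₀.length + 1)
  | 0 => ⟨rfl, fun _ => by show pot (rsInit S₀).work + 0 ≤ _; rw [pot_rsInit hS₀]⟩
  | n + 1 => by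
    obtain ⟨hok, hpot⟩ := rsRun_ok_and_pot hE hor hoc hS₀ hex n
    have hI := rsInv_iterate hE hor hS₀ n hok
    rw [Function.iterate_succ_apply']
    have hok' := ok_rsStep hE hoc hex hI hok
    refine ⟨hok', fun hw' => ?_⟩
    have hw : ((rsStep oracle k)^[n] (rsInit S₀)).work ≠ [] := fun h0 => by
      rw [rsStep_of_work_nil h0] at hw'; exact hw' h0
    have := pot_rsStep_lt hor hI hw hok'
    have := hpot hw
    omega

/-- **Completeness** (Cygan et al., Thm. 7.18, second half: the procedure does not report
`tw > k` when `tw ≤ k`): if `S₀` has a rooted tree decomposition (list form) covering the edges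
of the symmetric relation `E` inside `S₀` with all bags of size `≤ k + 1`, then over a sound and
complete oracle the run with fuel `≥ 2|S₀| + 1` succeeds. [cite: CyganEtAl2015, Thm 7.18] -/
theorem rsResult_isSome (hE : ∀ u v, E u v → E v u) (hor : OracleSound E k S₀ oracle) (hoc : OracleComplete E k S₀ oracle)
    (hS₀ : S₀.Nodup)
    (hex : ∃ par bags, IsRootedTDOn S₀.toFinset par bags ∧ CoversEdges S₀.toFinset E bags ∧
      ∀ t, t < bags.length → (bagOf bags t).length ≤ k + 1)
    {fuel : ℕ} (hfuel : 2 * S₀.length + 1 ≤ fuel) : (rsResult oracle k S₀ fuel).isSome = true := by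
  obtain ⟨hok, hpot⟩ := rsRun_ok_and_pot hE hor hoc hS₀ hex fuel
  have hwork : ((rsStep oracle k)^[fuel] (rsInit S₀)).work = [] := by
    by_contra hne
    have h1 := hpot hne
    have h2 : 1 ≤ pot ((rsStep oracle k)^[fuel] (rsInit S₀)).work := by
      rcases hw : ((rsStep oracle k)^[fuel] (rsInit S₀)).work with _ | ⟨τ, rest⟩
      · exact absurd hw hne
      · simp [pot, taskPot]; omega
    omega
  unfold rsResult rsRun
  rw [if_pos ⟨by rw [hwork]; rfl, hok⟩]
  rfl

end Completeness

end ListTD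

end Literature.Combinatorics.SimpleGraph
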